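import Summits.HodgeConjecture.HodgeConjecture.Theorems.R90S7RigidCoreDefs                          -- ★ p862183 `R90.S7.QsRigidCore` (Thm. 13.3.6 (c) on `U(Φ₃)` at print's pinned data; S7 file C's socket instantiates it)
import Summits.HodgeConjecture.HodgeConjecture.Theorems.R90S7ConjugatorSimilitude                   -- ★ p862548 (L0) `exists_formCongr_of_conj`: a conjugator `ψ_v` IS a form congruence `e_S⁻¹`
import Summits.HodgeConjecture.HodgeConjecture.Theorems.R90S7RigidCoreTransport                     -- ★ p862551: `exists_transportAPackets_xiPacketFamilyOfRecordSCD_eq`, `charIdentityAtTest_transport_of_frames`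
import Summits.HodgeConjecture.HodgeConjecture.Theorems.R90S9CongrOrbitalMeasureTransport            -- ★ S9: `isCanonical_transport_cmDatumLocalCongr_symm`, `isMulRightInvariant_map_cmDatumLocalCongr_symm`
import Summits.HodgeConjecture.HodgeConjecture.Theorems.F0P3SpectralPacketTransport                  -- ★ (N) 3f: `transportAPackets` (+ ★ `F0P3InnerFormClassificationV6.splitForm`, `Places`)
import Summits.HodgeConjecture.HodgeConjecture.Theorems.F0P3XiEvpOfRecordSCDSigned                  -- ★ `hSCD_of_cmCharIdentityPackageTestSigned`, `charIdentityAtTestSigned_hSCD` (the record's datum read off the SIGNED test package)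
import HarnessLib

/-!
# R90-TF · S7 (Ch. 14.6-tuple, C146) · S7-J2★ «O2 JUNCTION» — `pkRigidCore_of_qsRigidCore`: `(∀ L, QsRigidCore L)` ⇒ ORGAN 2 (O2′) OF THE LEAF, KIT-FREE
# ([Rogawski1990, §13.3 Thm. 13.3.6 (c) p. 202, Thm. 13.3.5 p. 202; §13.1 Prop. 13.1.4 p. 199; §14.1–14.2 pp. 232–234 «we fix an inner isomorphism ψ : G′ → G»])

Cell `hodgecm-mathlib`, crux H413 (`stmt-HodgeConjecture-24833`), route of record `HCCMUnconditional`; programme R90-TF (brief `director/R90-BRIEF.v2.md`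
1f40d54518340a35), section S7 = Rogawski §14.6 (base `R90-C146`), seat R90-C146-p01 (g0); deal S7-R8∕S7-J2★ «O2 JUNCTION, PROOF-FIRST» (LH7-plan (g4), R90 bus
2026-09-04T15:44:56Z) under RULINGS S7-R9 (B) (O2's honest upstream is O2's OWN BODY at `H := qsForm L`), S7-R10 (`hμω` folded: leaf ED. 6 = O2′), S7-R11 (a) Defs ∕ junction
split, (b) `πˢ` PINNED, S7-R12 (FLAG F-ψ RESOLVED BY THE TREE: pin (vii-c) ★ `ComparisonKit.PinPsiConj`, no ψ-hypothesis), S7-R13 (sequencing: after leaf ED. 6),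
S7-R14 (F2: datum `hSC` + pin `hSCid`).  Helper file, lane `--supports stmt-HodgeConjecture-24833 --as helper`; ONE theorem; no `def`, no instance, no notation, no `sorry`.

KIT-FREE SHAPE (`Theorems/` never import `Cruxes/…/Lines/`; the same discipline as the leaf's TIED organs ★ p848182 ∕ p848190 ∕ p848874): the statement below IS the leaf's
ORGAN 2 `F0U3LettersRung1.PKrigidCoreLetter` (ED. 6 «O2′», `Cruxes/H413/Lines/F0_P3c_PKtuplePaydown.lean` :224–:322) with the comparison kit DISSOLVED into the two fields
the organ reads — `ψ := 𝔨.ψ` with `hψ := hpin.psiConj` (pin (vii-c): `ψ_v g = S⁻¹ g S`) and `μG := 𝔨.μG` with `hAutG := hpin.2.2.1` —, the frame's `ι, T, hT` replaced by the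
two witnesses `hH := transpose_map_cmConjRingHom_eq_of_frame L ι H T hT`, `hHd := isUnit_det_of_frame L ι H T hT` they feed, every measurable structure `borel` EXACTLY as in
the letter, and the letter's UNUSED binders (`μ, ν, νGi, νqi, νHi, hvol, hvolH, c, wXi, jInf, dsInf, hTE, hSTF, hΔ, hmH, hmG, hLi, hg, hsm, S₀`) dropped.  S7 file C ED. 2 pays
the organ by the head `pkRigidCore_paid : PKrigidCoreLetter := by intro …; exact pkRigidCore_of_qsRigidCore stub_R90_S7_qsRigidCore L H (transpose_map_cmConjRingHom_eq_of_frame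
L ι H T hT) (isUnit_det_of_frame L ι H T hT) μω hμu hμω νH νG μZ isHaar_νH isRightInv_νH isHaar_νG isRightInv_νG isHaar_μZ hquad mH mG hcan 𝔨.ψ hpin.psiConj 𝔨.μG hpin.2.2.1 hQ
hK ξ π hocc hae v` (HOME snippet, GREEN by paste against the tree leaf ED. 6).

THE MATHEMATICS (pure transport, [Rogawski1990 §14.1–14.2 pp. 232–234 «identify `G′_v` and `G_v` … the equivalence classes of representations are canonically identified»]).
O2′ reads Thm. 13.3.6 (c) for the families `π` occurring in the discrete spectrum of `μG` on the quasi-split `G = U(Φ₃)`, but LABELS the packets `Π(ξ_v)` by the H-side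
record transported along `ψ_v` (★ `transportAPackets ψ Rec_H`).  (1) `hψ`: `ψ_v g = S⁻¹ g S`; by ★ L0 `exists_formCongr_of_conj` (the centraliser of `U(Φ₃)_v` is scalar)
`ᵗσS · H_v · S = m · Φ₃` with `m` a unit and `ψ_v = e_S⁻¹`, `e_S := cmDatumLocalCongr L v S hm h'`.  (2) ★ `exists_transportAPackets_xiPacketFamilyOfRecordSCD_eq`: the transported
H-record IS the intrinsic Φ₃-record ★ `xiPacketFamilyOfRecordSCD L (qsForm L) …` for the transported datum `hSC₀` (`πˢ₀ = πˢ_H ∘ e_S`; split places: the split packet rides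
the congruence; non-split places: a SELF-similitude of `Φ₃` is INNER on `U(Φ₃)_v`, odd rank).  (3) ★ `QsRigidCore L` is instantiated at print's Φ₃-side data MANUFACTURED
from the frame: `Δ := Δ‴_{Φ₃}` (`hΔ := rfl`), `m_H, ν_H, μω, hμu, hμω, μZ, hK, hquad` verbatim, `m_G ↦ e_S⁻¹_* m_G` (canonical on the regular classes: ★ S9
`isCanonical_transport_cmDatumLocalCongr_symm`), `ν_G ↦ e_S⁻¹_* ν_G` (Haar: Mathlib `ContinuousMulEquiv.isHaarMeasure_map`; right invariant: ★ S9
`isMulRightInvariant_map_cmDatumLocalCongr_symm`), `hSC := hSC₀`, and the PIN `hSCid` := ★ `charIdentityAtTest_transport_of_frames` fed with the H-side SIGNED identity ★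
`charIdentityAtTestSigned_hSCD … hQ` of O2′'s own package `hQ` (clause signs: `χ(m)·χ(a₁) = ε_v(H)² = 1 = χ(a″)`); `μG` automorphic by `hAutG`.  Then O2′'s a.e. premise and
its conclusion are `QsRigidCore L`'s, token for token after rewriting the record.  Hence O2′ = `QsRigidCore` read through `ψ`.

HONEST LABEL: a junction theorem closes no citation; `QsRigidCore L` (PRINT, global: Thm. 13.3.6 (c) + 13.3.5 on `U(3)`, stable trace formula) is the HYPOTHESIS, socketed by
S7 file C.  HC_CM is proved only modulo the 7 printed citations (2 remaining named inputs: hLiu418 = stmt-HodgeConjecture-24832, h413 = stmt-HodgeConjecture-24833) — until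
rung 0 closes.

## References
* [Rogawski1990] J. D. Rogawski, *Automorphic Representations of Unitary Groups in Three Variables*, Ann. of Math. Stud. 123 (1990): §13.3 Thm. 13.3.5,
  Thm. 13.3.6 (c) p. 202; §13.1 Prop. 13.1.3 (d), Prop. 13.1.4 p. 199; §12.2 (2) pp. 173–174; §14.1–§14.2 pp. 232–234; §14.6 p. 242.
* [BushnellHenniart2006] C. J. Bushnell, G. Henniart, *The Local Langlands Conjecture for GL(2)*, Grundlehren 335 (2006), §1.1.
* [LanglandsShelstad1987] R. P. Langlands, D. Shelstad, *On the definition of transfer factors*, Math. Ann. 278 (1987), §1, §4.2.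
-/

set_option autoImplicit false
-- the mandated namespace repeats the single-problem summit's segment (`HodgeConjecture.HodgeConjecture`)
set_option linter.dupNamespace false

noncomputable section

open NumberField IsDedekindDomain MeasureTheory
open scoped Matrix MatrixGroups

namespace Summit.HodgeConjecture.HodgeConjecture.R90.S7

open Literature.NumberTheory Literature.NumberTheory.Automorphic Literature.NumberTheory.Automorphic.UnitaryGroup
open Literature.NumberTheory.Rogawski1990 Literature.NumberTheory.GaloisRepresentations
open Summit.HodgeConjecture.HodgeConjecture.Cruxes.H413
open Summit.HodgeConjecture.HodgeConjecture.Cruxes.H413.F0P3InnerFormClassificationV6 (splitForm Places)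
open Summit.HodgeConjecture.HodgeConjecture.Cruxes.H413.F0P3XiPacketFamilyOfRecord (keysOfKeysCaseTwo)
open Summit.HodgeConjecture.HodgeConjecture.Cruxes.H413.F0P3XiPacketFamilyOfRecordSCD (xiPacketFamilyOfRecordSCD hSCD_of_cmCharIdentityPackageTestSigned
  charIdentityAtTestSigned_hSCD)
open Summit.HodgeConjecture.HodgeConjecture.Cruxes.H413.F0P3SpectralPacket (transportAPackets)

/-! ## The junction theorem (O2′, kit-free) -/

open scoped Classical in
set_option synthInstance.maxHeartbeats 400000 in
set_option maxHeartbeats 4000000 in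
/-- **S7-J2★ THE O2′ JUNCTION, KIT-FREE: `(∀ L, QsRigidCore L)` ⇒ RIGID-CORE over `transportAPackets ψ Rec_H`** — Thm. 13.3.6 (c) on the quasi-split `U(Φ₃)` at print's pinned
data (★ `R90.S7.QsRigidCore`, S7 file C's socket `stub_R90_S7_qsRigidCore`), read through local identifications `ψ_v : U(H)_v ≃ₜ* U(Φ₃)_v` that are matrix conjugations
(`hψ`, = the kit's pin (vii-c) `PinPsiConj`), IS the leaf's ORGAN 2 `F0U3LettersRung1.PKrigidCoreLetter` (ED. 6, O2′) with `ψ := 𝔨.ψ`, `μG := 𝔨.μG`: in O2′'s frame (`H`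
hermitian with unit determinant — the witnesses `hH, hHd` fed by `ι, T, hT` —, `μω` unitary restricting to `ω_{L∕L⁺}` (`hμω`), Haar data `νH, νG, μZ` (all `borel`, as in the
letter), `hquad`, canonical orbital families `mH, mG` (`hcan`), the SIGNED test package `hQ` of [13.1.4] on `U(H)`, Keys' case (2) `hK`), for every automorphic measure `μG` on
`U(Φ₃)(L⁺)∖U(Φ₃)(𝔸)`, every one-dimensional automorphic `ξ` of `U(2) × U(1)` and every family `π` of local classes OCCURRING IN THE DISCRETE SPECTRUM of `μG` with
`π_v = πⁿ(ξ_v)` (the unramified member of the transported record packet) for almost all finite `v`: `π_v ∈ Π(ξ_v) = {πⁿ(ξ_v)} ∪ πˢ(ξ_v)` at EVERY finite `v`.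
PROOF = pure transport along `ψ_v` [§14.1–14.2]: (1) ★ L0 `exists_formCongr_of_conj`: `ψ_v = e_S⁻¹`, `ᵗσS H S = m Φ₃`; (2) ★ `exists_transportAPackets_xiPacketFamilyOfRecordSCD_eq`:
the transported H-record IS the Φ₃-record for the transported datum `hSC₀`; (3) `QsRigidCore L` at `Δ‴_{Φ₃}` (`hΔ := rfl`), `m_H, ν_H`, `e_S⁻¹_* m_G` (★ S9
`isCanonical_transport_cmDatumLocalCongr_symm`), `e_S⁻¹_* ν_G` (Mathlib `ContinuousMulEquiv.isHaarMeasure_map`, ★ S9 `isMulRightInvariant_map_cmDatumLocalCongr_symm`), `μω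
hμu hμω μZ hK hquad` verbatim, `hSC := hSC₀`, `hSCid` := ★ `charIdentityAtTest_transport_of_frames` fed with ★ `charIdentityAtTestSigned_hSCD … hQ`, `μG` (automorphic,
`hAutG`).  No new hypothesis, no def. [cite: Rogawski1990, §13.3 Thm. 13.3.6 (c) p. 202; §14.1–14.2 pp. 232–234; §13.1 Prop. 13.1.4 p. 199] [cite: BushnellHenniart2006, §1.1] -/
theorem pkRigidCore_of_qsRigidCore (hQS : ∀ (L : Type) [Field L] [NumberField L] [IsCMField L], QsRigidCore L)
    (L : Type) [Field L] [NumberField L] [IsCMField L] (H : Matrix (Fin 3) (Fin 3) L)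
    (hH : (H.map (cmConjRingHom L))ᵀ = H) (hHd : IsUnit H.det) (μω : HeckeCharacter L) (hμu : μω.IsUnitary)
    (hμω : ∀ x : Literature.NumberTheory.GaloisRepresentations.ideleGroup ↥(maximalRealSubfield L),
      μω (AdeleRing.ideleBaseChange (↥(maximalRealSubfield L)) L x) = quadraticHeckeCharCM L x)
    (νH : ∀ v : Places L, @Measure
      ((cmDatum L 2 (Matrix.of fun i j : Fin 2 => if i.val + j.val + 1 = 2 then (1 : L) else 0)).Local v ×
        (cmDatum L 1 (Matrix.of fun i j : Fin 1 => if i.val + j.val + 1 = 1 then (1 : L) else 0)).Local v) (borel _))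
    (νG : ∀ v : Places L, @Measure ((cmDatum L 3 H).Local v) (borel _))
    (μZ : ∀ v : Places L, @Measure (Gqs L v ⧸ Subgroup.center (Gqs L v)) (borel _))
    (isHaar_νH : ∀ v : Places L, letI : MeasurableSpace (
      (cmDatum L 2 (Matrix.of fun i j : Fin 2 => if i.val + j.val + 1 = 2 then (1 : L) else 0)).Local v ×
        (cmDatum L 1 (Matrix.of fun i j : Fin 1 => if i.val + j.val + 1 = 1 then (1 : L) else 0)).Local v) := borel _; (νH v).IsHaarMeasure)
    (isRightInv_νH : ∀ v : Places L, letI : MeasurableSpace (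
      (cmDatum L 2 (Matrix.of fun i j : Fin 2 => if i.val + j.val + 1 = 2 then (1 : L) else 0)).Local v ×
        (cmDatum L 1 (Matrix.of fun i j : Fin 1 => if i.val + j.val + 1 = 1 then (1 : L) else 0)).Local v) := borel _; (νH v).IsMulRightInvariant)
    (isHaar_νG : ∀ v : Places L, letI : MeasurableSpace ((cmDatum L 3 H).Local v) := borel _; (νG v).IsHaarMeasure)
    (isRightInv_νG : ∀ v : Places L, letI : MeasurableSpace ((cmDatum L 3 H).Local v) := borel _; (νG v).IsMulRightInvariant)
    (isHaar_μZ : ∀ v : Places L, letI : MeasurableSpace (Gqs L v ⧸ Subgroup.center (Gqs L v)) := borel _; (μZ v).IsHaarMeasure)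
    (hquad : ∀ v : Places L, (∀ w : PlacesOver L v, IsCMField.complexConj L • w.1 = w.1) →
      IsQuadraticCharExtension (conjLocal L (IsCMField.complexConj L) v) (μω.semilocalComponent L v)) :
    letI : ∀ (v : Places L) (a : (cmDatum L 2 (Matrix.of fun i j : Fin 2 => if i.val + j.val + 1 = 2 then (1 : L) else 0)).Local v ×
        (cmDatum L 1 (Matrix.of fun i j : Fin 1 => if i.val + j.val + 1 = 1 then (1 : L) else 0)).Local v),
      MeasurableSpace (((cmDatum L 2 (Matrix.of fun i j : Fin 2 => if i.val + j.val + 1 = 2 then (1 : L) else 0)).Local v ×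
          (cmDatum L 1 (Matrix.of fun i j : Fin 1 => if i.val + j.val + 1 = 1 then (1 : L) else 0)).Local v) ⧸
        Subgroup.centralizer ({a} : Set ((cmDatum L 2 (Matrix.of fun i j : Fin 2 => if i.val + j.val + 1 = 2 then (1 : L) else 0)).Local v ×
          (cmDatum L 1 (Matrix.of fun i j : Fin 1 => if i.val + j.val + 1 = 1 then (1 : L) else 0)).Local v))) := fun _ _ => borel _
    letI : ∀ (v : Places L) (γ : (cmDatum L 3 H).Local v),
        MeasurableSpace ((cmDatum L 3 H).Local v ⧸ Subgroup.centralizer ({γ} : Set ((cmDatum L 3 H).Local v))) := fun _ _ => borel _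
    haveI : ∀ (v : Places L) (a : (cmDatum L 2 (Matrix.of fun i j : Fin 2 => if i.val + j.val + 1 = 2 then (1 : L) else 0)).Local v ×
        (cmDatum L 1 (Matrix.of fun i j : Fin 1 => if i.val + j.val + 1 = 1 then (1 : L) else 0)).Local v),
      BorelSpace (((cmDatum L 2 (Matrix.of fun i j : Fin 2 => if i.val + j.val + 1 = 2 then (1 : L) else 0)).Local v ×
          (cmDatum L 1 (Matrix.of fun i j : Fin 1 => if i.val + j.val + 1 = 1 then (1 : L) else 0)).Local v) ⧸
        Subgroup.centralizer ({a} : Set ((cmDatum L 2 (Matrix.of fun i j : Fin 2 => if i.val + j.val + 1 = 2 then (1 : L) else 0)).Local v ×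
          (cmDatum L 1 (Matrix.of fun i j : Fin 1 => if i.val + j.val + 1 = 1 then (1 : L) else 0)).Local v))) := fun _ _ => ⟨rfl⟩
    haveI : ∀ (v : Places L) (γ : (cmDatum L 3 H).Local v),
        BorelSpace ((cmDatum L 3 H).Local v ⧸ Subgroup.centralizer ({γ} : Set ((cmDatum L 3 H).Local v))) := fun _ _ => ⟨rfl⟩
    ∀ (mH : ∀ v : Places L, OrbitalMeasureFamily
        ((cmDatum L 2 (Matrix.of fun i j : Fin 2 => if i.val + j.val + 1 = 2 then (1 : L) else 0)).Local v ×
          (cmDatum L 1 (Matrix.of fun i j : Fin 1 => if i.val + j.val + 1 = 1 then (1 : L) else 0)).Local v))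
      (mG : ∀ v : Places L, OrbitalMeasureFamily ((cmDatum L 3 H).Local v)),
      letI : ∀ v : Places L, MeasurableSpace ((cmDatum L 3 H).Local v) := fun _ => borel _
      haveI : ∀ v : Places L, BorelSpace ((cmDatum L 3 H).Local v) := fun _ => ⟨rfl⟩
      letI : ∀ v : Places L, MeasurableSpace
        ((cmDatum L 2 (Matrix.of fun i j : Fin 2 => if i.val + j.val + 1 = 2 then (1 : L) else 0)).Local v ×
          (cmDatum L 1 (Matrix.of fun i j : Fin 1 => if i.val + j.val + 1 = 1 then (1 : L) else 0)).Local v) := fun _ => borel _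
      haveI : ∀ v : Places L, BorelSpace
        ((cmDatum L 2 (Matrix.of fun i j : Fin 2 => if i.val + j.val + 1 = 2 then (1 : L) else 0)).Local v ×
          (cmDatum L 1 (Matrix.of fun i j : Fin 1 => if i.val + j.val + 1 = 1 then (1 : L) else 0)).Local v) := fun _ => ⟨rfl⟩
      haveI : ∀ v : Places L, (νH v).IsHaarMeasure := isHaar_νH
      haveI : ∀ v : Places L, (νH v).IsMulRightInvariant := isRightInv_νH
      haveI : ∀ v : Places L, (νG v).IsHaarMeasure := isHaar_νG
      haveI : ∀ v : Places L, (νG v).IsMulRightInvariant := isRightInv_νG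
      (∀ v : Places L, (mH v).IsCanonical (IsLocalGRegular L v) (νH v) ∧
          (mG v).IsCanonical (fun γ => IsRegularElt (γ.val : GL (Fin 3) (UnitaryGroup.LocalRing L v))) (νG v)) →
      ∀ (ψ : ∀ v : Places L, (cmDatum L 3 H).Local v ≃ₜ* (cmDatum L 3 (splitForm L 3)).Local v)
        (_hψ : ∀ v : Places L, ∃ S : GL (Fin 3) (UnitaryGroup.LocalRing L v),
          ∀ g : (cmDatum L 3 H).Local v, ((ψ v g).val : GL (Fin 3) (UnitaryGroup.LocalRing L v)) = S⁻¹ * g.val * S)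
        (μG : Measure (cmDatum L 3 (splitForm L 3)).automorphicQuotient)
        (hAutG : (cmDatum L 3 (splitForm L 3)).IsAutomorphicMeasure μG)
        (hQ : CMCharIdentityPackageTestSigned L H hH hHd νH νG μω hμu
          (finExplicitCollection L H μω (finExplicitDelta_conj_left_all L H μω) (finExplicitDelta_conj_right_all L H μω)) mH mG)
        (hK : KeysCaseTwo L),
        letI : ∀ v : Places L, MeasurableSpace (Gqs L v ⧸ Subgroup.center (Gqs L v)) := fun _ => borel _
        haveI : ∀ v : Places L, BorelSpace (Gqs L v ⧸ Subgroup.center (Gqs L v)) := fun _ => ⟨rfl⟩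
        haveI : ∀ v : Places L, (μZ v).IsHaarMeasure := isHaar_μZ
        haveI hAut : (cmDatum L 3 (splitForm L 3)).IsAutomorphicMeasure μG := hAutG
        haveI : @SMulInvariantMeasure
            (adelicGroupData (↥(maximalRealSubfield L)) L (IsCMField.complexConj L) 3 (splitForm L 3)).Adelic
            (adelicGroupData (↥(maximalRealSubfield L)) L (IsCMField.complexConj L) 3 (splitForm L 3)).automorphicQuotient _
            (AdelicGroupData.instMeasurableSpaceAutomorphicQuotient
              (adelicGroupData (↥(maximalRealSubfield L)) L (IsCMField.complexConj L) 3 (splitForm L 3))) μG :=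
          hAut.toSMulInvariantMeasure
        letI : ∀ v : Places L, MeasurableSpace ((cmDatum L 3 (splitForm L 3)).Local v) := fun _ => borel _
        ∀ (ξ : OneDimAutRepH L) (π : ∀ v : Places L, IrrClass ((cmDatum L 3 (splitForm L 3)).Local v)),
          F0P3GlobalPacketDiscrete.cmOccursInDiscreteSpectrum L 3 (splitForm L 3) μG π →
          (∀ᶠ v in Filter.cofinite, π v = (transportAPackets ψ (xiPacketFamilyOfRecordSCD L H hH hHd μω hμu μZ (keysOfKeysCaseTwo L μω hK μZ hquad)
            (hSCD_of_cmCharIdentityPackageTestSigned L H hH hHd μω hμu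
              (finExplicitCollection L H μω (finExplicitDelta_conj_left_all L H μω) (finExplicitDelta_conj_right_all L H μω)) mH mG νG νH μZ hQ)) ξ v).πn) →
          ∀ v : Places L,
            (π v = (transportAPackets ψ (xiPacketFamilyOfRecordSCD L H hH hHd μω hμu μZ (keysOfKeysCaseTwo L μω hK μZ hquad)
              (hSCD_of_cmCharIdentityPackageTestSigned L H hH hHd μω hμu
                (finExplicitCollection L H μω (finExplicitDelta_conj_left_all L H μω) (finExplicitDelta_conj_right_all L H μω)) mH mG νG νH μZ hQ)) ξ v).πn ∨
            (transportAPackets ψ (xiPacketFamilyOfRecordSCD L H hH hHd μω hμu μZ (keysOfKeysCaseTwo L μω hK μZ hquad)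
              (hSCD_of_cmCharIdentityPackageTestSigned L H hH hHd μω hμu
                (finExplicitCollection L H μω (finExplicitDelta_conj_left_all L H μω) (finExplicitDelta_conj_right_all L H μω)) mH mG νG νH μZ hQ)) ξ v).πs =
              some (π v)) := by
  intro mH mG hcan ψ hψ μG hAutG hQ hK ξ π hocc hae v
  -- the frame's measurable structures, VERBATIM as in the letter (so that synthesised instances are the letter's)
  letI : ∀ (v : Places L) (a : (cmDatum L 2 (Matrix.of fun i j : Fin 2 => if i.val + j.val + 1 = 2 then (1 : L) else 0)).Local v ×
      (cmDatum L 1 (Matrix.of fun i j : Fin 1 => if i.val + j.val + 1 = 1 then (1 : L) else 0)).Local v),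
    MeasurableSpace (((cmDatum L 2 (Matrix.of fun i j : Fin 2 => if i.val + j.val + 1 = 2 then (1 : L) else 0)).Local v ×
        (cmDatum L 1 (Matrix.of fun i j : Fin 1 => if i.val + j.val + 1 = 1 then (1 : L) else 0)).Local v) ⧸
      Subgroup.centralizer ({a} : Set ((cmDatum L 2 (Matrix.of fun i j : Fin 2 => if i.val + j.val + 1 = 2 then (1 : L) else 0)).Local v ×
        (cmDatum L 1 (Matrix.of fun i j : Fin 1 => if i.val + j.val + 1 = 1 then (1 : L) else 0)).Local v))) := fun _ _ => borel _
  letI : ∀ (v : Places L) (γ : (cmDatum L 3 H).Local v),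
      MeasurableSpace ((cmDatum L 3 H).Local v ⧸ Subgroup.centralizer ({γ} : Set ((cmDatum L 3 H).Local v))) := fun _ _ => borel _
  haveI : ∀ (v : Places L) (a : (cmDatum L 2 (Matrix.of fun i j : Fin 2 => if i.val + j.val + 1 = 2 then (1 : L) else 0)).Local v ×
      (cmDatum L 1 (Matrix.of fun i j : Fin 1 => if i.val + j.val + 1 = 1 then (1 : L) else 0)).Local v),
    BorelSpace (((cmDatum L 2 (Matrix.of fun i j : Fin 2 => if i.val + j.val + 1 = 2 then (1 : L) else 0)).Local v ×
        (cmDatum L 1 (Matrix.of fun i j : Fin 1 => if i.val + j.val + 1 = 1 then (1 : L) else 0)).Local v) ⧸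
      Subgroup.centralizer ({a} : Set ((cmDatum L 2 (Matrix.of fun i j : Fin 2 => if i.val + j.val + 1 = 2 then (1 : L) else 0)).Local v ×
        (cmDatum L 1 (Matrix.of fun i j : Fin 1 => if i.val + j.val + 1 = 1 then (1 : L) else 0)).Local v))) := fun _ _ => ⟨rfl⟩
  haveI : ∀ (v : Places L) (γ : (cmDatum L 3 H).Local v),
      BorelSpace ((cmDatum L 3 H).Local v ⧸ Subgroup.centralizer ({γ} : Set ((cmDatum L 3 H).Local v))) := fun _ _ => ⟨rfl⟩
  letI : ∀ v : Places L, MeasurableSpace ((cmDatum L 3 H).Local v) := fun _ => borel _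
  haveI : ∀ v : Places L, BorelSpace ((cmDatum L 3 H).Local v) := fun _ => ⟨rfl⟩
  letI : ∀ v : Places L, MeasurableSpace
    ((cmDatum L 2 (Matrix.of fun i j : Fin 2 => if i.val + j.val + 1 = 2 then (1 : L) else 0)).Local v ×
      (cmDatum L 1 (Matrix.of fun i j : Fin 1 => if i.val + j.val + 1 = 1 then (1 : L) else 0)).Local v) := fun _ => borel _
  haveI : ∀ v : Places L, BorelSpace
    ((cmDatum L 2 (Matrix.of fun i j : Fin 2 => if i.val + j.val + 1 = 2 then (1 : L) else 0)).Local v ×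
      (cmDatum L 1 (Matrix.of fun i j : Fin 1 => if i.val + j.val + 1 = 1 then (1 : L) else 0)).Local v) := fun _ => ⟨rfl⟩
  haveI : ∀ v : Places L, (νH v).IsHaarMeasure := isHaar_νH
  haveI : ∀ v : Places L, (νH v).IsMulRightInvariant := isRightInv_νH
  haveI : ∀ v : Places L, (νG v).IsHaarMeasure := isHaar_νG
  haveI : ∀ v : Places L, (νG v).IsMulRightInvariant := isRightInv_νG
  letI : ∀ v : Places L, MeasurableSpace (Gqs L v ⧸ Subgroup.center (Gqs L v)) := fun _ => borel _
  haveI : ∀ v : Places L, BorelSpace (Gqs L v ⧸ Subgroup.center (Gqs L v)) := fun _ => ⟨rfl⟩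
  haveI : ∀ v : Places L, (μZ v).IsHaarMeasure := isHaar_μZ
  haveI hAut : (cmDatum L 3 (qsForm L)).IsAutomorphicMeasure μG := hAutG
  -- the Φ₃-side measurable structures (the letter's `borel` on `U(Φ₃)_v`; `borel` on the regular-class quotients)
  letI : ∀ v : Places L, MeasurableSpace ((cmDatum L 3 (qsForm L)).Local v) := fun _ => borel _
  haveI : ∀ v : Places L, BorelSpace ((cmDatum L 3 (qsForm L)).Local v) := fun _ => ⟨rfl⟩
  letI : ∀ (v : Places L) (γ : (cmDatum L 3 (qsForm L)).Local v),
      MeasurableSpace ((cmDatum L 3 (qsForm L)).Local v ⧸ Subgroup.centralizer ({γ} : Set ((cmDatum L 3 (qsForm L)).Local v))) := fun _ _ => borel _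
  haveI : ∀ (v : Places L) (γ : (cmDatum L 3 (qsForm L)).Local v),
      BorelSpace ((cmDatum L 3 (qsForm L)).Local v ⧸ Subgroup.centralizer ({γ} : Set ((cmDatum L 3 (qsForm L)).Local v))) := fun _ _ => ⟨rfl⟩
  -- (1) `ψ_v` is matrix conjugation (`hψ`), hence a form congruence `e_S⁻¹` (★ L0)
  choose S hS using hψ
  have hL0 := fun w : Places L => exists_formCongr_of_conj L w H hH hHd (ψ w) (S w) (hS w)
  choose m hm hσm h' hψe using hL0
  -- the same presentation in the `Ad(T₂)` currency of ★ `exists_transportAPackets_xiPacketFamilyOfRecordSCD_eq` (`T₂ := S⁻¹`)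
  have h'q : ∀ w : Places L, formCongr (conjLocal L (IsCMField.complexConj L) w) (S w) (H.map (algebraMap L (LocalRing L w))) =
      m w • (qsForm L).map (algebraMap L (LocalRing L w)) := h'
  have hψT : ∀ w : Places L, ∃ (T₂ : GL (Fin 3) (LocalRing L w)) (a₂ : LocalRing L w) (ha₂ : IsUnit a₂)
      (h₂ : formCongr (conjLocal L (IsCMField.complexConj L) w) T₂ ((qsForm L).map (algebraMap L (LocalRing L w))) =
        a₂ • H.map (algebraMap L (LocalRing L w))),
      ∀ g, ψ w g = cmDatumLocalCongr L w T₂ ha₂ h₂ g := fun w =>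
    ⟨(S w)⁻¹, _, ((hm w).unit⁻¹).isUnit, formCongr_inv_eq_smul_of_formCongr_eq_smul (S w) (hm w) _ _ (h'q w), fun g => by
      rw [hψe w]
      refine Subtype.ext ?_
      change (S w)⁻¹ * g.val * S w = (S w)⁻¹ * g.val * (S w)⁻¹⁻¹
      rw [inv_inv]⟩
  -- (2) the transported H-record is the Φ₃-record for the transported datum `hSC₀`
  obtain ⟨hSC₀, heq, hshape⟩ := exists_transportAPackets_xiPacketFamilyOfRecordSCD_eq L H hH hHd
    (F0P3cStCharTSCharField.qsForm_map_cmConjRingHom_transpose L) (F0P3cStCharTSShellOrbitalG.isUnit_det_qsForm L) μω hμu μZ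
    (keysOfKeysCaseTwo L μω hK μZ hquad)
    (hSCD_of_cmCharIdentityPackageTestSigned L H hH hHd μω hμu
      (finExplicitCollection L H μω (finExplicitDelta_conj_left_all L H μω) (finExplicitDelta_conj_right_all L H μω)) mH mG νG νH μZ hQ)
    ψ hψT
  have heq' : ∀ (ξ' : OneDimAutRepH L) (w : Places L),
      transportAPackets ψ (xiPacketFamilyOfRecordSCD L H hH hHd μω hμu μZ (keysOfKeysCaseTwo L μω hK μZ hquad)
        (hSCD_of_cmCharIdentityPackageTestSigned L H hH hHd μω hμu
          (finExplicitCollection L H μω (finExplicitDelta_conj_left_all L H μω) (finExplicitDelta_conj_right_all L H μω)) mH mG νG νH μZ hQ)) ξ' w =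
      xiPacketFamilyOfRecordSCD L (qsForm L) (F0P3cStCharTSCharField.qsForm_map_cmConjRingHom_transpose L)
        (F0P3cStCharTSShellOrbitalG.isUnit_det_qsForm L) μω hμu μZ (keysOfKeysCaseTwo L μω hK μZ hquad) hSC₀ ξ' w := fun ξ' w => heq ξ' w
  rw [heq'] at ⊢
  have hae' := hae.mono fun w (hw : π w = _) => (heq' ξ w ▸ hw :
    π w = (xiPacketFamilyOfRecordSCD L (qsForm L) (F0P3cStCharTSCharField.qsForm_map_cmConjRingHom_transpose L)
      (F0P3cStCharTSShellOrbitalG.isUnit_det_qsForm L) μω hμu μZ (keysOfKeysCaseTwo L μω hK μZ hquad) hSC₀ ξ w).πn)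
  -- (3) print's Φ₃-side data, manufactured from the frame by transport along `e_S`
  haveI hHaar₀ : ∀ w : Places L, ((νG w).map (cmDatumLocalCongr L w (S w) (hm w) (h' w)).symm).IsHaarMeasure := fun w =>
    ContinuousMulEquiv.isHaarMeasure_map (νG w) (cmDatumLocalCongr L w (S w) (hm w) (h' w)).symm
  haveI hRI₀ : ∀ w : Places L, ((νG w).map (cmDatumLocalCongr L w (S w) (hm w) (h' w)).symm).IsMulRightInvariant := fun w =>
    R90.S9.isMulRightInvariant_map_cmDatumLocalCongr_symm L H w (S w) (hm w) (h' w) (νG w)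
  have hcan₀ : ∀ w : Places L, (mH w).IsCanonical (IsLocalGRegular L w) (νH w) ∧
      ((mG w).transport (cmDatumLocalCongr L w (S w) (hm w) (h' w)).symm.toMulEquiv (cmDatumLocalCongr L w (S w) (hm w) (h' w)).symm.continuous
        (cmDatumLocalCongr L w (S w) (hm w) (h' w)).continuous).IsCanonical
        (fun γ => IsRegularElt (γ.val : GL (Fin 3) (UnitaryGroup.LocalRing L w))) ((νG w).map (cmDatumLocalCongr L w (S w) (hm w) (h' w)).symm) :=
    fun w => ⟨(hcan w).1, R90.S9.isCanonical_transport_cmDatumLocalCongr_symm L H w (S w) (hm w) (h' w) (νG w) _ rfl (hcan w).2⟩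
  -- ★ `QsRigidCore L` at these data (its four leading measurable-structure binders are synthesised here, from the letter's `borel` choices)
  have hQs := hQS L
  refine @hQs
    (finExplicitCollection L (qsForm L) μω (finExplicitDelta_conj_left_all L (qsForm L) μω) (finExplicitDelta_conj_right_all L (qsForm L) μω))
    mH
    (fun w => (mG w).transport (cmDatumLocalCongr L w (S w) (hm w) (h' w)).symm.toMulEquiv (cmDatumLocalCongr L w (S w) (hm w) (h' w)).symm.continuous
      (cmDatumLocalCongr L w (S w) (hm w) (h' w)).continuous)
    (fun w => (νG w).map (cmDatumLocalCongr L w (S w) (hm w) (h' w)).symm) νH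
    _ _ _ _ hHaar₀ hRI₀ _ _ μω hμu hμω rfl hcan₀ _ _ μZ _ hK hquad hSC₀ (fun ξ' w hns T' a ha h π2 πn hk hn => ?_) μG hAut ξ π hocc hae' v
  -- the PIN `hSCid` for the transported datum: the H-side signed identity of `hQ` rides `e_S` (★ `charIdentityAtTest_transport_of_frames`)
  obtain ⟨T₁, a₁, ha₁, h₁, hval⟩ := hshape ξ' w hns T' a ha h π2 πn hk hn
  rw [hval, hψe w, ContinuousMulEquiv.symm_symm]
  exact charIdentityAtTest_transport_of_frames L H w μω hns hH hHd (S w) (hm w) (h' w) (mH w) (mG w) (νG w) (νH w) (ξ'.xiLocalChar w)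
    T₁ a₁ ha₁ h₁ T' a ha h πn _
    (charIdentityAtTestSigned_hSCD L H hH hHd μω hμu
      (finExplicitCollection L H μω (finExplicitDelta_conj_left_all L H μω) (finExplicitDelta_conj_right_all L H μω)) mH mG νG νH μZ hQ
      ξ' w hns T₁ a₁ ha₁ h₁ π2 πn hk hn)

end Summit.HodgeConjecture.HodgeConjecture.R90.S7

end
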